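import Literature.Combinatorics.Additive.GlobalLevelInequalityBiglobal
import Literature.Combinatorics.AssociationSchemes.HomogeneousMatchingFamilies
import HarnessLib

/-!
# The matching-side level-`k` inequality for REAL WEIGHTS (modulo Keevash–Lifshitz 2023, Theorem 3.1)

Cell pnp-psdrank (summit PneNP, rung F-N2, route `ChebyshevTracialDesign`, crux stmt-PneNP-19878). The input
«(F2)» of the `r = 1` rung — `MatchingLevelInequality.closedSum_sq_le_of_homogeneous` and its `PMatch` form
`HomogeneousMatchingFamilies.pmatch_closedSum_sq_le` — bounds `(Σ_{M ∈ Y} Π_p(M))²` for a homogeneous SET `Y`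
of perfect matchings, because its source, the named fact `GlobalLevelDInequality` (Keevash–Lifshitz Thm 1.8),
is a statement about indicator functions. A psd version of the rung (prover MEMO-12 §3 (2): the
Hilbert–Schmidt form of the layer expansion, weights `y(M) = Y_M[q,p] ∈ [−1, 1]`, the entries of a
contraction) needs the same inequality for `Σ_{M ∈ Y} y(M) Π_p(M)` with an ARBITRARY weight
`y : PM_n → [−1, 1]`. In print this is the paper's general Theorem 3.1 (level-`d` inequality for biglobal
FUNCTIONS; tree: the named fact `GlobalLevelDInequalityBiglobal` with its weighted dual form
`GlobalLevelDInequalityBiglobal.dual_indicator_mul`, module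
`Literature/Combinatorics/Additive/GlobalLevelInequalityBiglobal.lean`): the function `y · 1_{Ỹ}` on `S_n` is
biglobal with the parameters of the pull-back SET `Ỹ`, uniformly in `y` (lit memo LIT-20 §3). This module is the
pull-back `S_n → PM_n` of that weighted form, verbatim along the tree's unweighted route
(`MatchingLevelInequality` §6–§8: the fibres of `σ ↦ σ s σ⁻¹` have the constant size `|C(s)|`,
`sum_filter_conj_mem`; homogeneous families pull back to `√τ`-global sets, `isGlobal_pullback`):

* `closedSum_sq_le_weighted` — for `Ỹ` `r`-global and every `y : PM_n → [−1,1]`: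
  `(Σ_{π ∈ Y} y(π) Π_p(π))² ≤ ν² (C r⁴ k⁻¹ log(1/ν))^k · |PM_n| · Σ_{π ∈ PM_n} Π_p(π)²`, `C = 2·10⁶`;
* `closedSum_sq_le_of_homogeneous_weighted` — the same for `Y` `τ`-homogeneous (Kupavskii–Zakharov), with
  `C τ²` in place of `C r⁴`: the drop-in weighted twin of «(F2)»;
* `pmatch_closedSum_sq_le_weighted` — the `PMatch n` form with the kernel's functional
  `Σ_{T : #{x ∈ T : M.partner x ∈ T} = k} p_T`, the drop-in weighted twin of
  `HomogeneousMatchingFamilies.pmatch_closedSum_sq_le`.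

All three are modulo the named fact `GlobalLevelDInequalityBiglobal` (hypothesis `h`), exactly as the set
versions are modulo `GlobalLevelDInequality` (which the wider fact implies:
`GlobalLevelDInequality_of_biglobal`). No new facts here. WHAT THIS IS NOT: not a proof of Theorem 3.1;
nothing about psd rank; no P-vs-NP content.
-/

noncomputable section

namespace Literature.Combinatorics.AssociationSchemes.MatchingLevelInequality

open Finset Equiv
open scoped InnerProductSpace
open Literature.Barriers.PneNP
open Literature.Combinatorics.SetFamily
open Literature.Combinatorics.AssociationSchemes.JohnsonHarmonics
open Literature.Combinatorics.AssociationSchemes.HomogeneousMatchingFamilies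
open Literature.Combinatorics.Additive.KeevashLifshitz

variable {n : ℕ}

/-- `Σ_{σ ∈ Ỹ} y(σ s σ⁻¹) G_p(σ) = |C(s)| · Σ_{π ∈ Y} y(π) Π_p(π)`: the left side of Theorem 3.1's weighted dual
form for `(Ỹ, y ∘ (σ ↦ σ s σ⁻¹), G_p)`. [cite: KeevashLifshitz2023, Thm. 3.1] -/
theorem sum_pullback_weight_pullVec (s : Perm (Fin n)) (hs : s ∈ fpfInvolutions n) {Y : Finset (Perm (Fin n))}
    (hY : Y ⊆ fpfInvolutions n) (y : Perm (Fin n) → ℝ) (k : ℕ) (p : Finset (Fin n) → ℝ) :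
    ∑ σ ∈ pullback s Y, y (σ * s * σ⁻¹) * pullVec s k p σ =
      ((transporters s s).card : ℝ) * ∑ π ∈ Y, y π * closedSum k p π := by
  rw [← sum_filter_conj_mem s hs hY (fun π => y π * closedSum k p π)]
  rfl

/-- **THE MATCHING-SIDE LEVEL-`k` INEQUALITY FOR REAL WEIGHTS (modulo Keevash–Lifshitz Thm 3.1).** Let `s` be a
perfect matching of `[n]`, `Y ⊆ PM_n` a set of perfect matchings whose pull-back `Ỹ = {σ : σ s σ⁻¹ ∈ Y}` is
`r`-global (Def. 1.6), `ν = |Y|/|PM_n|`, `y : PM_n → [−1, 1]` ANY weight, and `p` a harmonic coefficient vector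
of degree `k` with `1 ≤ k ≤ min(⅛ log(1/ν), 10⁻⁵ n)`. Then
`(Σ_{π ∈ Y} y(π) Π_p(π))² ≤ ν² · (C r⁴ k⁻¹ log(1/ν))^k · |PM_n| · Σ_{π ∈ PM_n} Π_p(π)²` with `C = 2·10⁶` — the
same right-hand side as the set version `closedSum_sq_le` (which is `y ≡ 1`). Proof: Theorem 3.1's weighted
dual form for the biglobal function `(y ∘ conj_s) · 1_Ỹ` against the pure degree-`k` test vector `G_p`; the
fibres of `σ ↦ σ s σ⁻¹` all have size `|C(s)|`, which cancels. [cite: KeevashLifshitz2023, Thm. 3.1] -/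
theorem closedSum_sq_le_weighted (h : GlobalLevelDInequalityBiglobal) :
    ∃ C : ℝ, 0 < C ∧ ∀ (n : ℕ) (s : Perm (Fin n)), s ∈ fpfInvolutions n →
      ∀ (Y : Finset (Perm (Fin n))), Y ⊆ fpfInvolutions n →
      ∀ (y : Perm (Fin n) → ℝ), (∀ π, |y π| ≤ 1) →
      ∀ (r : ℝ) (k : ℕ) (p : Finset (Fin n) → ℝ), 1 ≤ k → IsHarmonic k p →
      IsGlobal r (pullback s Y) →
      (k : ℝ) ≤ Real.log (1 / ((Y.card : ℝ) / (fpfInvolutions n).card)) / 8 →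
      (k : ℝ) ≤ (n : ℝ) / 10 ^ 5 →
      (∑ π ∈ Y, y π * closedSum k p π) ^ 2 ≤
        ((Y.card : ℝ) / (fpfInvolutions n).card) ^ 2 *
          (C * r ^ 4 * (1 / (k : ℝ)) * Real.log (1 / ((Y.card : ℝ) / (fpfInvolutions n).card))) ^ k *
          ((fpfInvolutions n).card * ∑ π ∈ fpfInvolutions n, closedSum k p π ^ 2) := by
  refine ⟨2 * 10 ^ 6, by norm_num, fun n s hs Y hY y hy r k p hk hp hglob h8 hn => ?_⟩
  have hdens := card_pullback_div s hs hY
  have hmain := h.dual_indicator_mul n (pullback s Y) r k (fun σ => y (σ * s * σ⁻¹)) (pullVec s k p) hk hglob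
    (fun σ => hy _) (by rw [hdens]; exact h8) hn
    (pullVec_mem_degLE s k p) (fun w hw => inner_pullVec_eq_zero_of_mem_degLE (by omega) s hp hw)
  rw [hdens, sum_pullback_weight_pullVec s hs hY, norm_pullVec_sq s hs, factorial_eq_card_mul s hs] at hmain
  set c : ℝ := ((transporters s s).card : ℝ) with hc_def
  have hc : (0 : ℝ) < c := by
    have : (transporters s s).Nonempty := ⟨1, mem_filter.2 ⟨mem_univ _, by simp⟩⟩
    rw [hc_def]; exact_mod_cast card_pos.2 this
  set A : ℝ := ∑ π ∈ Y, y π * closedSum k p π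
  set B : ℝ := ∑ π ∈ fpfInvolutions n, closedSum k p π ^ 2
  set N : ℝ := ((fpfInvolutions n).card : ℝ)
  set K : ℝ := ((Y.card : ℝ) / N) ^ 2 *
    (2 * 10 ^ 6 * r ^ 4 * (1 / (k : ℝ)) * Real.log (1 / ((Y.card : ℝ) / N))) ^ k
  -- `hmain : (c A)² ≤ c B · (c N) · K`; divide by `c² > 0`
  have h' : c ^ 2 * A ^ 2 ≤ c ^ 2 * (K * (N * B)) := by
    calc c ^ 2 * A ^ 2 = (c * A) ^ 2 := by ring
      _ ≤ c * B * (c * N) * K := hmain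
      _ = c ^ 2 * (K * (N * B)) := by ring
  exact le_of_mul_le_mul_left h' (by positivity)

/-- **(F2) FOR REAL WEIGHTS AND HOMOGENEOUS FAMILIES (modulo Keevash–Lifshitz Thm 3.1).** For `Y ⊆ PM_n`
`τ`-homogeneous in the sense of Kupavskii–Zakharov (`τ ≥ 1`), `ν = |Y|/|PM_n|`, ANY weight `y : PM_n → [−1,1]`,
and a harmonic coefficient vector `p` of degree `k` with `1 ≤ k ≤ min(⅛ log(1/ν), 10⁻⁵ n)`:
`(Σ_{π ∈ Y} y(π) Π_p(π))² ≤ ν² · (C τ² k⁻¹ log(1/ν))^k · |PM_n| · Σ_{π ∈ PM_n} Π_p(π)²`, `C = 2·10⁶` — the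
drop-in weighted twin of `closedSum_sq_le_of_homogeneous`. [cite: KeevashLifshitz2023, Thm. 3.1] -/
theorem closedSum_sq_le_of_homogeneous_weighted (h : GlobalLevelDInequalityBiglobal) :
    ∃ C : ℝ, 0 < C ∧ ∀ (n : ℕ) (s : Perm (Fin n)), s ∈ fpfInvolutions n →
      ∀ (Y : Finset (Perm (Fin n))), Y ⊆ fpfInvolutions n →
      ∀ (y : Perm (Fin n) → ℝ), (∀ π, |y π| ≤ 1) →
      ∀ (τ : ℝ) (k : ℕ) (p : Finset (Fin n) → ℝ), 1 ≤ τ → IsHomogeneousMatchingFamily τ Y →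
      1 ≤ k → IsHarmonic k p →
      (k : ℝ) ≤ Real.log (1 / ((Y.card : ℝ) / (fpfInvolutions n).card)) / 8 →
      (k : ℝ) ≤ (n : ℝ) / 10 ^ 5 →
      (∑ π ∈ Y, y π * closedSum k p π) ^ 2 ≤
        ((Y.card : ℝ) / (fpfInvolutions n).card) ^ 2 *
          (C * τ ^ 2 * (1 / (k : ℝ)) * Real.log (1 / ((Y.card : ℝ) / (fpfInvolutions n).card))) ^ k *
          ((fpfInvolutions n).card * ∑ π ∈ fpfInvolutions n, closedSum k p π ^ 2) := by
  obtain ⟨C, hC, hmain⟩ := closedSum_sq_le_weighted h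
  refine ⟨C, hC, fun n s hs Y hY y hy τ k p hτ hYh hk hp h8 hn => ?_⟩
  have hglob := isGlobal_pullback hτ hYh hY hs
  have := hmain n s hs Y hY y hy (Real.sqrt τ) k p hk hp hglob h8 hn
  have hτ0 : (0 : ℝ) ≤ τ := zero_le_one.trans hτ
  rwa [show Real.sqrt τ ^ 4 = τ ^ 2 by
    rw [show (4 : ℕ) = 2 * 2 by norm_num, pow_mul, Real.sq_sqrt hτ0]] at this

/-- **(F2) FOR REAL WEIGHTS IN THE KERNEL'S CURRENCY (modulo Keevash–Lifshitz Thm 3.1).** For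
`Y : Finset (PMatch n)` whose family of edge sets is `(perfectMatchings univ, τ)`-homogeneous (`τ ≥ 1`),
`ν = |Y|/|PMatch n|`, ANY weight `y : PMatch n → [−1, 1]`, and a harmonic `p` of degree `k` with
`1 ≤ k ≤ min(⅛ log(1/ν), 10⁻⁵ n)`, the weighted matching-side sums of the bi-mode expansion satisfy
`(Σ_{M ∈ Y} y(M) Σ_{T : #{x∈T : M.partner x ∈ T} = k} p_T)² ≤ ν²·(C τ² k⁻¹ log(1/ν))^k·|PMatch n|·Σ_{M : PMatch n} (Σ_T …)²`,
`C = 2·10⁶` — the drop-in weighted twin of `HomogeneousMatchingFamilies.pmatch_closedSum_sq_le`.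
[cite: KeevashLifshitz2023, Thm. 3.1] -/
theorem pmatch_closedSum_sq_le_weighted (h : GlobalLevelDInequalityBiglobal) :
    ∃ C : ℝ, 0 < C ∧ ∀ (n : ℕ) (Y : Finset (PMatch n)) (y : PMatch n → ℝ) (τ : ℝ) (k : ℕ)
      (p : Finset (Fin n) → ℝ), (∀ M, |y M| ≤ 1) → 1 ≤ τ →
      IsRelHomogeneous τ (perfectMatchings (univ : Finset (Fin n))) (Y.image Subtype.val) →
      1 ≤ k → IsHarmonic k p →
      (k : ℝ) ≤ Real.log (1 / ((Y.card : ℝ) / Fintype.card (PMatch n))) / 8 →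
      (k : ℝ) ≤ (n : ℝ) / 10 ^ 5 →
      (∑ M ∈ Y, y M *
          ∑ T ∈ univ.filter (fun T : Finset (Fin n) => (T.filter fun x => M.2.partner x ∈ T).card = k), p T) ^ 2 ≤
        ((Y.card : ℝ) / Fintype.card (PMatch n)) ^ 2 *
          (C * τ ^ 2 * (1 / (k : ℝ)) * Real.log (1 / ((Y.card : ℝ) / Fintype.card (PMatch n)))) ^ k *
          ((Fintype.card (PMatch n) : ℝ) *
            ∑ M : PMatch n,
              (∑ T ∈ univ.filter (fun T : Finset (Fin n) => (T.filter fun x => M.2.partner x ∈ T).card = k), p T) ^ 2) := by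
  obtain ⟨C, hC, hmain⟩ := closedSum_sq_le_of_homogeneous_weighted h
  refine ⟨C, hC, fun n Y y τ k p hy hτ hhom hk hp h8 hn => ?_⟩
  -- rewrite the kernel's functional as `closedSum k p (toPerm M)`
  have hfun : ∀ M : PMatch n,
      ∑ T ∈ univ.filter (fun T : Finset (Fin n) => (T.filter fun x => M.2.partner x ∈ T).card = k), p T =
        closedSum k p (toPerm M) := by
    intro M
    rw [← closedSum_eq_sum_filter_card hp.1 (toPerm M)]
    refine sum_congr ?_ fun _ _ => rfl
    ext T
    simp only [mem_filter, mem_univ, true_and, toPerm_apply]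
  simp_rw [hfun]
  rcases Y.eq_empty_or_nonempty with hYe | ⟨M₀, hM₀⟩
  · rw [hYe, sum_empty, card_empty, Nat.cast_zero, zero_div]
    have : ((0 : ℝ)) ^ 2 = 0 := by norm_num
    rw [this, zero_mul, zero_mul]
  · -- transport the weight along the injection `toPerm`
    set y' : Perm (Fin n) → ℝ := Function.extend toPerm y 0 with hy'_def
    have hy' : ∀ π, |y' π| ≤ 1 := by
      intro π
      by_cases hπ : ∃ M, toPerm M = π
      · obtain ⟨M, rfl⟩ := hπ
        rw [hy'_def, toPerm_injective.extend_apply]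
        exact hy M
      · rw [hy'_def, Function.extend_apply' _ _ _ hπ]
        simp
    have hs : toPerm M₀ ∈ fpfInvolutions n := toPerm_mem M₀
    have hY : Y.image toPerm ⊆ fpfInvolutions n := by
      intro π hπ
      obtain ⟨M, -, rfl⟩ := mem_image.1 hπ
      exact toPerm_mem M
    have hYh : IsHomogeneousMatchingFamily τ (Y.image toPerm) := by
      rw [← image_permOf_image_val]
      exact isHomogeneousMatchingFamily_image_permOf (image_val_subset Y) hhom
    have key := hmain n (toPerm M₀) hs (Y.image toPerm) hY y' hy' τ k p hτ hYh hk hp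
    rw [card_image_of_injective _ toPerm_injective, ← card_pmatch_eq,
      sum_image_toPerm Y (fun π => y' π * closedSum k p π), sum_fpfInvolutions_eq_sum_pmatch] at key
    simp_rw [hy'_def, toPerm_injective.extend_apply] at key
    exact key h8 hn

end Literature.Combinatorics.AssociationSchemes.MatchingLevelInequality
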